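import Summits.BirchSwinnertonDyer.BirchSwinnertonDyer.Theorems.TwoAdicConverseBDPSelmerLowerDivisibilityAtTwoGaussContent
import HarnessLib

/-!
# Line sketch `cm_theta_twin_two` — crux `BDPSelmerLowerDivisibilityAtTwo` (O2), crux-ideate r1 seat 2 GEN 5

NODE (D-0171 shape; lens `recomb2`).  The registered line of record for O2 is `two_variable_gv_squeeze_two` v5
(stubs U = `stub_upperInclusionRat`, R0T = `stub_frameTorsion`, ACPIN = `stub_acFibrePinning`; card §R:
R ⟸ R0 ∧ R_alg ∧ R_μ ∧ R_KMC ∧ R_an).  This file types the **CM theta-twin** supply for the residual leaf: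
per datum, in the value ring `A₂ = 𝒪_{ℂ₂}⟦T₁⟧⟦T₂⟧` with reduction `red₂` to `𝔽̄₂⟦T₁⟧⟦T₂⟧`,

* `C`  = a generator of `ch_{Λ_K}(X_Gr(E/K̃_∞))·A₂` (P0, kernel: `TwoAdicBDPCharIdealPrincipal.exists_xGr₂_charIdeal_eq_span_two`),
* `G`  = the two-variable Greenberg series of the newform `f = f_E` (O2's own `∃ G`, leaf R0G),
* `G'` = the two-variable Greenberg series of a CM TWIN `g = θ_ψ`, `ψ` a Hecke character of THE SAME `K` of infinity
  type `(1,0)` with trivial residual character `ψ̄ = 𝟙` at the prime `𝔓 ∣ 2` of the coefficient field (exists: twist any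
  type-`(1,0)` character by the Teichmüller lift of `ψ̄⁻¹`), and
* `C'` = a generator of `ch_{Λ_K}(X_Gr(g/K̃_∞))·A₂ = ch(𝔛(ψ)) · ch(𝔛(ψ^c))` (the twin's Greenberg module SPLITS
  2-adically into two one-prime-ramified GL(1) Iwasawa modules over `K̃_∞`, because `V_g|_{G_K} = ψ_𝔓 ⊕ ψ^c_𝔓`).

PIECES (tags per D-0171; tests in the card `Ideas/cm-theta-twin-two.md`):
* TWIN-AN  `TwinAnalyticCongruence G G'` : `red₂ G = ū · red₂ G'` — on habitat (β) (`E(ℚ)[2] ≠ 0`) one has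
  `a_ℓ(f) ≡ 0 (mod 2)` for every odd good `ℓ`, whence `f^♭ ≡ Σ_{m odd, (m,Σ)=1} q^{m²} ≡ θ_ψ^♭ (mod 𝔓)` as
  `Σ`-depleted 2-adic modular forms; linearity of the CM-period-normalised two-variable measure in the form +
  q-expansion principle (Kriz–Li 2019 Thm 3.9 is the value-level instance AT `p = 2`).  [UNDECIDED at measure
  level: needs the construction R0G at 2 — shared leaf; value level in print]
* TWIN-MC  `TwinMainConjecture G' C'` : `(G') = (C')` in `A₂` and `red₂ C' ≠ 0` — Rubin/Johnson-Leung–Kings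
  two-variable GL(1) main conjecture at `2` (JLK 2011 Thm 5.2, «all primes p») for the two branches, BDP 2012
  Thm 2.13-type factorisation `G' ≐ Tw_Ψ 𝓛_{v} · Tw_{Ψ^c} 𝓛_{v}` with BOTH factors inside Katz's interpolation
  range, and the two-variable `μ = 0` inputs already named R_μ (Li 2025, CKL 2019, Crişan–Müller).  [WEAKER than
  O2; ATTACKABLE = print-port + one 2-adic Γ-factor bookkeeping (the `2^{r+1+2j}` of BDP12 (55))]
* TWIN-ALG `TwinAlgebraicComparison C C'` : `(red₂ C) = (red₂ C')` — Greenberg–Vatsal residual comparison over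
  `K̃_∞` between `E[2]|_{G_K}` (extension of `𝟙` by `𝟙`) and `ψ̄ ⊕ ψ̄^c = 𝟙 ⊕ 𝟙`; λ/divisor-additivity of the
  Σ-imprimitive dévissage is extension-class blind (= the line's R_alg identity `div χ₂(X_E^Σ) = 2·div χ₂(𝔛^Σ)`,
  kernel algebra + p-uniform finiteness).  [WEAKER; ATTACKABLE]
Composition: the three pieces give EXACTLY the residual hypotheses `(red₂ G) = (red₂ C)`, `red₂ C ≠ 0` of the
LANDED Gauss-content lemma `TwoAdicBDPGaussContent.span_le_span_of_two_pow_mul_eq_of_residue` (p766427), so with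
U (`2^m · G = C · h`) the per-datum O2 containment `(C) ≤ (G)` follows — `lowerInclusion_of_twin` below, sorry-free.
The frame-level glue to O2 BY NAME is the line's own `bdpSelmerLowerDivisibilityAtTwo_of_split_pieces`
(P0 → S → U → R0T → Rres → O2); this node supplies Rres.

Nothing here proves O2, O2♭ or any case of BSD; typed ≠ proved.  No `sorry`.
-/

set_option autoImplicit false
set_option linter.dupNamespace false

noncomputable section

open scoped Classical
open PowerSeries Literature.NumberTheory.EllipticCurves

namespace Summit.BirchSwinnertonDyer.BirchSwinnertonDyer.Cruxes.BDPSelmerLowerDivisibilityAtTwo.CmThetaTwinTwo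

/-! ## §1 Generic twin transport of a residual span (kernel algebra, any coefficient ring) -/

section Generic

variable {A Ω : Type*} [CommRing A] [CommRing Ω] (red : A →+* Ω)

/-- Reduction of a principal-ideal equality. [folklore] -/
theorem span_red_eq_of_span_eq {x y : A} (h : Ideal.span ({x} : Set A) = Ideal.span {y}) :
    Ideal.span ({red x} : Set Ω) = Ideal.span {red y} := by
  have := congrArg (Ideal.map red) h
  simpa [Ideal.map_span, Set.image_singleton] using this

/-- **Twin transport.**  If `red G` is a unit multiple of `red G'` (TWIN-AN), `(G') = (C')` (TWIN-MC) and
`(red C) = (red C')` (TWIN-ALG), then `(red G) = (red C)`. [folklore] -/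
theorem span_red_eq_of_twin {G G' C C' : A} {u : Ω} (hu : IsUnit u) (hAN : red G = u * red G')
    (hMC : Ideal.span ({G'} : Set A) = Ideal.span {C'})
    (hALG : Ideal.span ({red C} : Set Ω) = Ideal.span {red C'}) :
    Ideal.span ({red G} : Set Ω) = Ideal.span {red C} := by
  rw [hAN, Ideal.span_singleton_mul_left_unit hu, span_red_eq_of_span_eq red hMC, hALG]

/-- Non-vanishing of the reduction transports along an equality of residual spans. [folklore] -/
theorem red_ne_zero_of_span_eq {C C' : A} (hALG : Ideal.span ({red C} : Set Ω) = Ideal.span {red C'})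
    (hμ : red C' ≠ 0) : red C ≠ 0 := by
  intro h0
  have hmem : red C' ∈ Ideal.span ({red C} : Set Ω) := hALG ▸ Ideal.mem_span_singleton_self _
  rw [h0, Ideal.span_singleton_zero] at hmem
  exact hμ ((Submodule.mem_bot Ω).mp hmem)

end Generic

/-! ## §2 The pieces at `p = 2` in O2's value ring and the node's composition -/

/-- O2's value ring `𝒪_{ℂ₂}⟦T₁⟧⟦T₂⟧` (the `toUnr₂`-target of the frame). -/
abbrev A₂ : Type := PowerSeries (PowerSeries (PadicComplexInt 2))

/-- Its special fibre `𝔽̄₂⟦T₁⟧⟦T₂⟧`. -/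
abbrev Ω₂ : Type := PowerSeries (PowerSeries (IsLocalRing.ResidueField (PadicComplexInt 2)))

/-- Coefficientwise reduction `red₂ : A₂ →+* Ω₂` (the map in the Gauss-content lemma). -/
def red₂ : A₂ →+* Ω₂ := PowerSeries.map (PowerSeries.map (IsLocalRing.residue (PadicComplexInt 2)))

/-- **TWIN-AN** at a datum: the Greenberg series `G` of `f_E` and `G'` of the CM twin `θ_ψ` have unit-proportional
reductions in `𝔽̄₂⟦T₁⟧⟦T₂⟧`.  [cite: Kriz–Li 2019 (doi:10.1017/fms.2019.9) Thm 3.9 — value-level instance at p = 2] -/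
def TwinAnalyticCongruence (G G' : A₂) : Prop := ∃ u : Ω₂, IsUnit u ∧ red₂ G = u * red₂ G'

/-- **TWIN-MC** at a datum: the twin's two-variable main conjecture as an equality of principal ideals of `A₂`, with
`μ = 0` (`red₂ C' ≠ 0`).  [cite: Johnson-Leung–Kings 2011 (arXiv:0804.2828) Thm 5.2; BDP 2012 (doi:10.2140/pjm.2012.260.261) Thm 2.13] -/
def TwinMainConjecture (G' C' : A₂) : Prop := Ideal.span ({G'} : Set A₂) = Ideal.span {C'} ∧ red₂ C' ≠ 0

/-- **TWIN-ALG** at a datum: the characteristic series of `X_Gr(E/K̃_∞)` and of the twin's (split) Greenberg module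
have the same residual divisor.  [cite: Greenberg–Vatsal 2000 §2; Lei–Müller–Xia 2023 (arXiv:2302.06553) §3 (p odd)] -/
def TwinAlgebraicComparison (C C' : A₂) : Prop := Ideal.span ({red₂ C} : Set Ω₂) = Ideal.span {red₂ C'}

/-- **The node's composition (sorry-free).**  U-shape `2^m · G = C · h` + TWIN-AN + TWIN-MC + TWIN-ALG ⟹ the per-datum
O2 containment `(C) ≤ (G)`, through the landed Gauss-content lemma (p766427). [folklore] -/
theorem lowerInclusion_of_twin (C G h G' C' : A₂) (m : ℕ) (hU : (2 : A₂) ^ m * G = C * h)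
    (hAN : TwinAnalyticCongruence G G') (hMC : TwinMainConjecture G' C') (hALG : TwinAlgebraicComparison C C') :
    Ideal.span ({C} : Set A₂) ≤ Ideal.span {G} := by
  obtain ⟨u, hu, hGu⟩ := hAN
  have hGC : Ideal.span ({red₂ G} : Set Ω₂) = Ideal.span {red₂ C} := span_red_eq_of_twin red₂ hu hGu hMC.1 hALG
  have hC : red₂ C ≠ 0 := red_ne_zero_of_span_eq red₂ hALG hMC.2
  exact Summit.BirchSwinnertonDyer.BirchSwinnertonDyer.Theorems.TwoAdicBDPGaussContent.span_le_span_of_two_pow_mul_eq_of_residue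
    C G h m hU hC hGC

/-! ### μ-robust version (the given curve's `X_Gr` may have `μ > 0` at `2` inside its isogeny class) -/

/-- `2` is not a unit of `𝒪_{ℂ₂}` (`‖2‖ = 1/2`). [folklore] -/
theorem not_isUnit_two_padicComplexInt : ¬ IsUnit ((2 : ℕ) : PadicComplexInt 2) := by
  intro h
  have h1 : ‖(((2 : ℕ) : PadicComplexInt 2) : ℂ_[2])‖ = 1 := isUnit_padicComplexInt_iff.mp h
  have hnorm : ‖((2 : ℕ) : ℂ_[2])‖ = (2 : ℝ)⁻¹ := by
    rw [← map_natCast (algebraMap ℚ_[2] ℂ_[2]) 2]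
    exact (PadicComplex.norm_extends' (p := 2) ((2 : ℕ) : ℚ_[2])).trans Padic.norm_p
  have hcoe : (((2 : ℕ) : PadicComplexInt 2) : ℂ_[2]) = ((2 : ℕ) : ℂ_[2]) := by push_cast; rfl
  rw [hcoe, hnorm] at h1
  norm_num at h1

/-- `2` reduces to `0` in the residue field of `𝒪_{ℂ₂}`. [folklore] -/
theorem residue_two_eq_zero : IsLocalRing.residue (PadicComplexInt 2) 2 = 0 := by
  rw [IsLocalRing.residue_eq_zero_iff, IsLocalRing.mem_maximalIdeal, mem_nonunits_iff]
  have h : (2 : PadicComplexInt 2) = ((2 : ℕ) : PadicComplexInt 2) := by rw [Nat.cast_ofNat]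
  rw [h]; exact not_isUnit_two_padicComplexInt

/-- `red₂ 2 = 0`. [folklore] -/
theorem red₂_two : red₂ (2 : A₂) = 0 := by
  have h : (2 : Ω₂) = PowerSeries.C (PowerSeries.C (IsLocalRing.residue (PadicComplexInt 2) 2)) := by
    rw [map_ofNat, map_ofNat, map_ofNat]
  rw [map_ofNat, h, residue_two_eq_zero, map_zero, map_zero]

/-- `2 ≠ 0` in `A₂`. [folklore] -/
theorem two_ne_zero_A₂ : (2 : A₂) ≠ 0 := by
  have h2 : (2 : PadicComplexInt 2) ≠ 0 := by
    have := natCast_prime_padicComplexInt_ne_zero (p := 2); rwa [Nat.cast_ofNat] at this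
  rw [show (2 : A₂) = PowerSeries.C (PowerSeries.C 2) by rw [map_ofNat, map_ofNat]]
  exact Summit.BirchSwinnertonDyer.BirchSwinnertonDyer.Theorems.TwoAdicBDPGaussContent.C_C_ne_zero h2

/-- **The node's composition, μ-robust form (sorry-free).**  Here `C = 2^e · C₀` splits off the `μ`-part of the
algebraic characteristic series (`C₀` = its `μ`-free part, the object the divisor `χ₂` of R_alg actually reads) and
TWIN-ALG compares `C₀` with the twin.  If `e > m` the U-relation would force `red₂ G = 0`, contradicting TWIN-AN +
TWIN-MC; otherwise the Gauss-content lemma applies to `(C₀, G, h, m - e)`. [folklore] -/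
theorem lowerInclusion_of_twin_mu (C C₀ G h G' C' : A₂) (m e : ℕ) (hU : (2 : A₂) ^ m * G = C * h)
    (hP : C = (2 : A₂) ^ e * C₀) (hAN : TwinAnalyticCongruence G G') (hMC : TwinMainConjecture G' C')
    (hALG : TwinAlgebraicComparison C₀ C') : Ideal.span ({C} : Set A₂) ≤ Ideal.span {G} := by
  obtain ⟨u, hu, hGu⟩ := hAN
  have hGC : Ideal.span ({red₂ G} : Set Ω₂) = Ideal.span {red₂ C₀} :=
    span_red_eq_of_twin red₂ hu hGu hMC.1 hALG
  have hC₀ : red₂ C₀ ≠ 0 := red_ne_zero_of_span_eq red₂ hALG hMC.2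
  have hG0 : red₂ G ≠ 0 := red_ne_zero_of_span_eq red₂ hGC hC₀
  rcases Nat.lt_or_ge m e with hme | hem
  · obtain ⟨k, hk⟩ := Nat.exists_eq_add_of_lt hme
    have hG : G = (2 : A₂) ^ (k + 1) * (C₀ * h) := by
      refine mul_left_cancel₀ (pow_ne_zero m two_ne_zero_A₂) ?_
      rw [hU, hP, hk]; ring
    rw [hG, map_mul, map_pow, red₂_two, zero_pow (Nat.succ_ne_zero k), zero_mul] at hG0
    exact absurd rfl hG0
  · obtain ⟨k, rfl⟩ := Nat.exists_eq_add_of_le hem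
    have hk : (2 : A₂) ^ k * G = C₀ * h := by
      refine mul_left_cancel₀ (pow_ne_zero e two_ne_zero_A₂) ?_
      rw [← mul_assoc, ← pow_add, hU, hP, mul_assoc]
    have h1 : Ideal.span ({C₀} : Set A₂) ≤ Ideal.span {G} :=
      Summit.BirchSwinnertonDyer.BirchSwinnertonDyer.Theorems.TwoAdicBDPGaussContent.span_le_span_of_two_pow_mul_eq_of_residue
        C₀ G h k hk hC₀ hGC
    exact le_trans (Ideal.span_singleton_le_span_singleton.mpr ⟨(2 : A₂) ^ e, by rw [hP, mul_comm]⟩) h1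

/-- **Residual-equality shape** delivered to the registered squeeze (the hypotheses `hC`, `hGC` of the S lemma),
recorded separately so a lead can plug the twin into `stub_residualEquality` / Rres without U. [folklore] -/
theorem residualEquality_of_twin (C G G' C' : A₂) (hAN : TwinAnalyticCongruence G G')
    (hMC : TwinMainConjecture G' C') (hALG : TwinAlgebraicComparison C C') :
    red₂ C ≠ 0 ∧ Ideal.span ({red₂ G} : Set Ω₂) = Ideal.span {red₂ C} := by
  obtain ⟨u, hu, hGu⟩ := hAN
  exact ⟨red_ne_zero_of_span_eq red₂ hALG hMC.2, span_red_eq_of_twin red₂ hu hGu hMC.1 hALG⟩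

/-- **Line-level reading (feeds ACPIN's leaf (N)_L):** non-degeneracy of `G` along any specialisation `φ : Ω₂ →+* Ω'`
(e.g. restriction of the special fibre to the anticyclotomic or cyclotomic line) transports from the twin:
`φ (red₂ G) ≠ 0 ↔ φ (red₂ G') ≠ 0`. [folklore] -/
theorem lineNondegeneracy_iff_of_twin {Ω' : Type*} [CommRing Ω'] (φ : Ω₂ →+* Ω') {G G' : A₂}
    (hAN : TwinAnalyticCongruence G G') : φ (red₂ G) ≠ 0 ↔ φ (red₂ G') ≠ 0 := by
  obtain ⟨u, hu, hGu⟩ := hAN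
  have hφu : IsUnit (φ u) := hu.map φ
  rw [hGu, map_mul]
  constructor
  · intro h h0; exact h (by rw [h0, mul_zero])
  · intro h h0; exact h (hφu.mul_right_eq_zero.mp h0)

end Summit.BirchSwinnertonDyer.BirchSwinnertonDyer.Cruxes.BDPSelmerLowerDivisibilityAtTwo.CmThetaTwinTwo

end
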